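/-
HODGE LADDER — STAGE 4, road (R1) for rows 1 and 3b (powers/products of K3 surfaces; powers of cubic fourfolds),
kernel-typed modulo ONE named published fact (André 1996 Thm. 0.6.3 / 7.1 / 7.2 with §6.3).  Sibling of
`CorCM/Stage4Interfaces.lean` (at the 400-line limit) and `CorCM/Stage4RowOneInstances.lean`.
Literature seat hodge-director-lit-stage4, gen 3; companion document
run/shared/lean/pub/hodge-director/STAGE4-ABELIAN-MOTIVIC-TYPE.md (v3, §0/§1/§3 and CHANGES IN v3).
-/
import Summits.HodgeConjecture.CorCM.Stage4Interfaces
import Literature.AlgebraicGeometry.Andre1996.AbelianTypePiecesHodgeClassesMotivated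
import HarnessLib

/-!
# Stage 4, road (R1) for rows 1 and 3b: `B` for all smooth projective complex varieties ⟹ `HC_K3Powers`, `HC_K3Pairs`, `HC_CubicFourfoldPowers`

The v1/v2 interface file types road (R1) — Grothendieck's standard conjecture `B` (the tree's real-carrier
`StandardConjectureBStar`) for ALL smooth projective complex varieties — for rows 2a/2b (`K3^[n]`, `Kumⁿ`; modulo
Soldatenkov 2022 Cor. 1.2) and for stage 3's conclusion (`HC_AV_of_B`; modulo André 1996 Thm. 0.6.2).  This file
does the same for the remaining André rows: the Literature record
`Andre1996.Andre1996_hodgeClasses_motivated_of_isAbelianTypePiece` (André 1996 Thm. 0.6.3 = Thms. 7.1/7.2 with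
§4.5, §6.1 and the full faithfulness of §6.3, p. 31: every Hodge class on a PRODUCT of abelian varieties,
projective K3 surfaces and smooth cubic hypersurfaces of `ℙⁿ`, `n ≤ 6`, is motivated; carrier
`Andre1996.IsAbelianTypePiece d X`) makes every Hodge class on `Sᵐ`, `S × S'`, `Xᵐ` (cubic fourfold `X`),
`S × A`, … motivated, and under `B` motivated classes are algebraic (André §0.3; the tree's PROVED assembly, with
the cup-product step fed from the tree THEOREM
`HodgeConjecture.Theorems.Voisin2003_cupProduct_algebraicClasses_holds`).  Consequences recorded (kernel wiring,
nothing asserted beyond the named fact taken as a hypothesis):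
* `hc_abelianTypePiece_of_B_of_andre` — `B` ∀ ⟹ the Hodge conjecture for every product of André's generators;
* `hc_K3Powers_of_B_of_andre`, `hc_K3Pairs_of_B_of_andre`, `hc_cubicFourfoldPowers_of_B_of_andre` — the row-1
  targets `HC_K3Powers`, `HC_K3Pairs` and the row-3b target `HC_CubicFourfoldPowers` under `B`, modulo the
  single record; `HC_AV` is NOT an input (as for rows 2a/2b);
* `hc_av_of_B_of_andre_pieces` — SR-1 (`HC_AV_of_B`) from the same record (its abelian-variety case is
  Thm. 0.6.2, `Andre1996_hodgeClasses_motivated_of_isAbelianTypePiece.abelianVariety_motivated_of`);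
* `hodgeClasses_absoluteHodge_abelianTypePiece` — the Deligne-1982-type input of the coordinator's list for
  rows 1/3b: every Hodge class on such a product is absolute Hodge (André Prop. 2.5.1 BY NAME).
So after this file EVERY row of the stage-4 table with a typed target (1, 2a, 2b, 3b; and SR-1 ⟹ stage 3) has
road (R1) kernel-typed modulo exactly one named published fact each (André 1996 Thm. 0.6.3+§6.3, resp.
Soldatenkov 2022 Cor. 1.2, resp. André 1996 Thm. 0.6.2).
-/

noncomputable section

open CategoryTheory MonoidalCategory
open Literature.AlgebraicGeometry
open Literature.AlgebraicGeometry.Motives (SchemeOver IsSmoothProjective AbelianVariety)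
open Literature.AlgebraicGeometry.HodgeTheory
open Literature.AlgebraicGeometry.Surfaces (IsK3Surface)
open Literature.AlgebraicGeometry.Andre1996 (IsAbelianTypePiece Andre1996_hodgeClasses_motivated_of_isAbelianTypePiece)

namespace Summit.HodgeConjecture.CorCM.Stage4

/-- Road (R1), all André rows at once: Grothendieck's `B` for ALL smooth projective complex varieties ⟹ the
Hodge conjecture for every product of André's generators of `M(Ab)_𝒱` (abelian varieties, projective K3
surfaces, smooth cubic hypersurfaces of `ℙⁿ`, `n ≤ 6`; `Andre1996.IsAbelianTypePiece d X`), GIVEN the named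
fact "Hodge ⟹ motivated on such products" (André 1996 Thm. 0.6.3 / 7.1 / 7.2 with §6.3) BY NAME; the
cup-product step is the tree's theorem `HodgeConjecture.Theorems.Voisin2003_cupProduct_algebraicClasses_holds`.
`HC_AV` is not an input. [cite: Andre1996Motifs, Thm. 0.6.3 (p. 9), §6.3 (p. 31) and §0.3 (p. 7)] -/
theorem hc_abelianTypePiece_of_B_of_andre (hA : Andre1996_hodgeClasses_motivated_of_isAbelianTypePiece)
    (hB : ∀ (d : ℕ) (Z : SchemeOver ℂ) (η : complexBetti Z 2), IsSmoothProjective d Z → StandardConjectureBStar d Z η)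
    {d : ℕ} {X : SchemeOver ℂ} (hX : IsAbelianTypePiece d X) : HodgeConjectureFor d X :=
  Andre1996_hodgeClasses_motivated_of_isAbelianTypePiece.hodgeConjectureFor_of_lefschetzStandardB hA
    Summit.HodgeConjecture.HodgeConjecture.Theorems.Voisin2003_cupProduct_algebraicClasses_holds hB hX

/-- Road (R1), row 1a: `B` ∀ ⟹ `HC_K3Powers` (the Hodge conjecture for all powers of all projective K3
surfaces), modulo the single André record. [cite: Andre1996Motifs, Thm. 7.1 (p. 35) and §6.3 (p. 31)] -/
theorem hc_K3Powers_of_B_of_andre (hA : Andre1996_hodgeClasses_motivated_of_isAbelianTypePiece)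
    (hB : ∀ (d : ℕ) (Z : SchemeOver ℂ) (η : complexBetti Z 2), IsSmoothProjective d Z → StandardConjectureBStar d Z η) :
    HC_K3Powers :=
  fun _ hS m ↦ hc_abelianTypePiece_of_B_of_andre hA hB (IsAbelianTypePiece.k3_pow hS m)

/-- Road (R1), row 1b: `B` ∀ ⟹ `HC_K3Pairs` (the Hodge conjecture for `S × S'`, `S`, `S'` projective K3
surfaces), modulo the single André record. [cite: Andre1996Motifs, Thm. 7.1 (p. 35) and §6.3 (p. 31)] -/
theorem hc_K3Pairs_of_B_of_andre (hA : Andre1996_hodgeClasses_motivated_of_isAbelianTypePiece)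
    (hB : ∀ (d : ℕ) (Z : SchemeOver ℂ) (η : complexBetti Z 2), IsSmoothProjective d Z → StandardConjectureBStar d Z η) :
    HC_K3Pairs :=
  fun _ _ hS hS' ↦ hc_abelianTypePiece_of_B_of_andre hA hB (IsAbelianTypePiece.k3_tensor_k3 hS hS')

/-- Road (R1), row 3b: `B` ∀ ⟹ `HC_CubicFourfoldPowers` (the Hodge conjecture for all powers of all smooth
cubic fourfolds), modulo the single André record (Thm. 7.2, case `n = 5`). [cite: Andre1996Motifs, Thm. 7.2 (p. 35) and §6.3 (p. 31)] -/
theorem hc_cubicFourfoldPowers_of_B_of_andre (hA : Andre1996_hodgeClasses_motivated_of_isAbelianTypePiece)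
    (hB : ∀ (d : ℕ) (Z : SchemeOver ℂ) (η : complexBetti Z 2), IsSmoothProjective d Z → StandardConjectureBStar d Z η) :
    HC_CubicFourfoldPowers :=
  fun _ hX m ↦ hc_abelianTypePiece_of_B_of_andre hA hB (IsAbelianTypePiece.cubicFourfold_pow hX m)

/-- Road (R1), row 1 with an abelian factor: `B` ∀ ⟹ the Hodge conjecture for `S × A`, `S` a projective K3
surface, `A` a complex abelian variety (row 1 of the companion document: "K3 × abelian"), modulo the single
André record. [cite: Andre1996Motifs, Thm. 7.1 (p. 35), §6.1 (p. 30) and §6.3 (p. 31)] -/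
theorem hc_K3_tensor_abelianVariety_of_B_of_andre (hA : Andre1996_hodgeClasses_motivated_of_isAbelianTypePiece)
    (hB : ∀ (d : ℕ) (Z : SchemeOver ℂ) (η : complexBetti Z 2), IsSmoothProjective d Z → StandardConjectureBStar d Z η)
    {S : SchemeOver ℂ} (hS : IsK3Surface S) (A : AbelianVariety ℂ) : HodgeConjectureFor (2 + A.dim) (S ⊗ A.X) :=
  hc_abelianTypePiece_of_B_of_andre hA hB (IsAbelianTypePiece.k3_tensor_abelianVariety hS A)

/-- SR-1 from the same record: its abelian-variety case is André's Thm. 0.6.2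
(`Andre1996_hodgeClasses_motivated_of_isAbelianTypePiece.abelianVariety_motivated_of`), so `HC_AV_of_B` follows by
the v2.1 theorem `hc_av_of_B_of_andre1996_thm_0_6_2`. [cite: Andre1996Motifs, Thm. 0.6.2 (p. 9) and §6.3 Remarque 2 (p. 33)] -/
theorem hc_av_of_B_of_andre_pieces (hA : Andre1996_hodgeClasses_motivated_of_isAbelianTypePiece) : HC_AV_of_B :=
  hc_av_of_B_of_andre1996_thm_0_6_2
    (Andre1996_hodgeClasses_motivated_of_isAbelianTypePiece.abelianVariety_motivated_of hA)

/-- CITE, kernel wiring (the Deligne-1982-type input of the coordinator's list, rows 1/3b): every Hodge class on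
a product of André's generators — in particular on `Sᵐ`, `S × S'`, `Xᵐ` (cubic fourfold), `S × A` — is an
ABSOLUTE HODGE class, GIVEN the André record and André 1996 Prop. 2.5.1 BY NAME
(`Andre1996_isAbsoluteHodgeClass_of_mem_motivatedClasses`).  What it gives the ladder: the kill criterion of
the motivated road is met on these rows; what it does NOT give: algebraicity.
[cite: Andre1996Motifs, Prop. 2.5.1 (p. 18), Thm. 0.6.3 (p. 9) and §6.3 (p. 31)] -/
theorem hodgeClasses_absoluteHodge_abelianTypePiece (hA : Andre1996_hodgeClasses_motivated_of_isAbelianTypePiece)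
    (hAH : Andre1996_isAbsoluteHodgeClass_of_mem_motivatedClasses) {d : ℕ} {X : SchemeOver ℂ}
    (hX : IsAbelianTypePiece d X) (p : ℕ) (c : complexBetti X (2 * p)) (hc : IsRationalClass c)
    (hpp : IsOfHodgeType d X (2 * p) p p c) : IsAbsoluteHodgeClass d X p c :=
  Andre1996_hodgeClasses_motivated_of_isAbelianTypePiece.hodgeClasses_absoluteHodge_of hA hAH hX p c hc hpp

end Summit.HodgeConjecture.CorCM.Stage4

end
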